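import Mathlib
import HarnessLib.Audit

/-!
# MODEL: a 16-point cube carries no affine zero set inside a level set of `x₁x₂ + x₃x₄` (E2 node N4X; prover-1 g20)

FRONTIER range-avoidance ladder, rung F-N3 (`stmt-PneNP-19007`), cell `pnp-ideate` (`PstarGateNodesX.GateCaseTQuadX`, used by
`PstarGateCaseTQuadThree`); restricted-model proof complexity — nothing here bears on `P` versus `NP`.

Pure `𝔽₂`-algebra on the cube `Fin n → 𝔽₂`: four distinct coordinates `a₀, a₁, a₂, a₃`, a function `A` with the flip rules of
`x_{a₀}x_{a₁} + x_{a₂}x_{a₃}` and a function `Q` with flip rules `Q(z + e_{aᵢ}) = Q z + Lᵢ z`, the `Lᵢ` invariant under the four flips (so `Q`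
is affine on every 16-point cube `y ⊕ s`).  If every zero of `Q` on the cube of `y` lies in one level set of `A`, then `Q` has no zero there:

* `affine_zero_free` — the decided finite statement;
* `cube16` — its cube form.
-/

set_option linter.dupNamespace false -- `Summit.PneNP.PneNP.…`: summit = sub-problem name (D-0017 single-conjunct layout)

namespace Summit.PneNP.PneNP.Theorems.PstarGateCaseTQuadCube

variable {n : ℕ}

/-! ## Model: no affine zero set inside a level set of `x₁x₂ + x₃x₄` -/

/-- **Decided**: an affine function `Qy + Σ sᵢ lᵢ` of `s ∈ 𝔽₂⁴` whose zeros all satisfy `Ay + s₁y₂ + s₂(y₁+s₁) + s₃y₄ + s₄(y₃+s₃) = k`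
has no zeros. -/
theorem affine_zero_free (Ay y₁ y₂ y₃ y₄ Qy l₁ l₂ l₃ l₄ k : ZMod 2)
    (h : ∀ s₁ s₂ s₃ s₄ : ZMod 2, Qy + s₁ * l₁ + s₂ * l₂ + s₃ * l₃ + s₄ * l₄ = 0 →
      Ay + s₁ * y₂ + s₂ * (y₁ + s₁) + s₃ * y₄ + s₄ * (y₃ + s₃) = k) :
    Qy = 1 ∧ l₁ = 0 ∧ l₂ = 0 ∧ l₃ = 0 ∧ l₄ = 0 := by
  have z01 : ∀ t : ZMod 2, t = 0 ∨ t = 1 := by decide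
  rcases z01 y₁ with rfl | rfl <;> rcases z01 y₂ with rfl | rfl <;> rcases z01 y₃ with rfl | rfl <;> rcases z01 y₄ with rfl | rfl <;>
    revert h <;> revert Ay Qy l₁ l₂ l₃ l₄ k <;> decide

/-- **The 16-point cube**: `Q` with flip rules `Q(z + eᵢ) = Q z + Lᵢ z`, the `Lᵢ` invariant under the four flips; `A` with the flip rules of
`x_{a₁}x_{a₂} + x_{a₃}x_{a₄}`; if every zero of `Q` on the cube of `y` has `A = k`, then `Q y = 1` and all `Lᵢ y = 0`. -/
theorem cube16 {Q A : (Fin n → ZMod 2) → ZMod 2} {L : Fin 4 → (Fin n → ZMod 2) → ZMod 2} {a : Fin 4 → Fin n}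
    (hQ : ∀ i z, Q (z + Pi.single (a i) 1) = Q z + L i z)
    (hL : ∀ i j z, L i (z + Pi.single (a j) 1) = L i z)
    (hA0 : ∀ z, A (z + Pi.single (a 0) 1) = A z + z (a 1)) (hA1 : ∀ z, A (z + Pi.single (a 1) 1) = A z + z (a 0))
    (hA2 : ∀ z, A (z + Pi.single (a 2) 1) = A z + z (a 3)) (hA3 : ∀ z, A (z + Pi.single (a 3) 1) = A z + z (a 2))
    (h02 : a 0 ≠ a 2) (h03 : a 0 ≠ a 3) (h12 : a 1 ≠ a 2) (h13 : a 1 ≠ a 3)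
    (y : Fin n → ZMod 2) (k : ZMod 2)
    (hZ : ∀ s₁ s₂ s₃ s₄ : ZMod 2,
      Q (y + s₁ • Pi.single (a 0) 1 + s₂ • Pi.single (a 1) 1 + s₃ • Pi.single (a 2) 1 + s₄ • Pi.single (a 3) 1) = 0 →
      A (y + s₁ • Pi.single (a 0) 1 + s₂ • Pi.single (a 1) 1 + s₃ • Pi.single (a 2) 1 + s₄ • Pi.single (a 3) 1) = k) :
    Q y = 1 ∧ L 0 y = 0 ∧ L 1 y = 0 ∧ L 2 y = 0 ∧ L 3 y = 0 := by
  have z01 : ∀ t : ZMod 2, t = 0 ∨ t = 1 := by decide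
  -- one scaled flip
  have hQs : ∀ i z (s : ZMod 2), Q (z + s • Pi.single (a i) 1) = Q z + s * L i z := by
    intro i z s
    rcases z01 s with rfl | rfl
    · rw [zero_smul, add_zero, zero_mul, add_zero]
    · rw [one_smul, one_mul, hQ]
  have hLs : ∀ i j z (s : ZMod 2), L i (z + s • Pi.single (a j) 1) = L i z := by
    intro i j z s
    rcases z01 s with rfl | rfl
    · rw [zero_smul, add_zero]
    · rw [one_smul, hL]
  have hAs : ∀ {i j : Fin 4}, (∀ z, A (z + Pi.single (a i) 1) = A z + z (a j)) → ∀ z (s : ZMod 2),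
      A (z + s • Pi.single (a i) 1) = A z + s * z (a j) := by
    intro i j h z s
    rcases z01 s with rfl | rfl
    · rw [zero_smul, add_zero, zero_mul, add_zero]
    · rw [one_smul, one_mul, h]
  have hc : ∀ (i : Fin 4) (c : Fin n) (s : ZMod 2) (z : Fin n → ZMod 2), c ≠ a i →
      ((z + s • Pi.single (a i) (1 : ZMod 2) : Fin n → ZMod 2) c) = z c := by
    intro i c s z hc
    rw [Pi.add_apply, Pi.smul_apply, Pi.single_eq_of_ne hc, smul_zero, add_zero]
  have hcs : ∀ (i : Fin 4) (s : ZMod 2) (z : Fin n → ZMod 2), ((z + s • Pi.single (a i) (1 : ZMod 2) : Fin n → ZMod 2) (a i)) = z (a i) + s := by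
    intro i s z
    rw [Pi.add_apply, Pi.smul_apply, Pi.single_eq_same, smul_eq_mul, mul_one]
  refine affine_zero_free (A y) (y (a 0)) (y (a 1)) (y (a 2)) (y (a 3)) (Q y) (L 0 y) (L 1 y) (L 2 y) (L 3 y) k fun s₁ s₂ s₃ s₄ hs => ?_
  have hQ4 : Q (y + s₁ • Pi.single (a 0) 1 + s₂ • Pi.single (a 1) 1 + s₃ • Pi.single (a 2) 1 + s₄ • Pi.single (a 3) 1) =
      Q y + s₁ * L 0 y + s₂ * L 1 y + s₃ * L 2 y + s₄ * L 3 y := by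
    rw [hQs 3 _ s₄, hLs 3 2, hLs 3 1, hLs 3 0, hQs 2 _ s₃, hLs 2 1, hLs 2 0, hQs 1 _ s₂, hLs 1 0, hQs 0 _ s₁]
  have hA4 : A (y + s₁ • Pi.single (a 0) 1 + s₂ • Pi.single (a 1) 1 + s₃ • Pi.single (a 2) 1 + s₄ • Pi.single (a 3) 1) =
      A y + s₁ * y (a 1) + s₂ * (y (a 0) + s₁) + s₃ * y (a 3) + s₄ * (y (a 2) + s₃) := by
    rw [hAs hA3 _ s₄, hcs 2, hc 1 (a 2) _ _ (Ne.symm h12), hc 0 (a 2) _ _ (Ne.symm h02), hAs hA2 _ s₃, hc 1 (a 3) _ _ (Ne.symm h13),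
      hc 0 (a 3) _ _ (Ne.symm h03), hAs hA1 _ s₂, hcs 0, hAs hA0 _ s₁]
  have hs' := hs
  rw [← hQ4] at hs'
  have h := hZ s₁ s₂ s₃ s₄ hs'
  rw [hA4] at h
  exact h

end Summit.PneNP.PneNP.Theorems.PstarGateCaseTQuadCube
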